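import Summits.FinalStateConjecture.FinalStateConjecture.Theorems.DrainImpliesDisperse.Negative.DrainImpliesDisperseFalseOfPulsedObserver
import Summits.FinalStateConjecture.FinalStateConjecture.Theorems.BondiDrainDispersalDrainImpliesDisperseSlabAchronal
import HarnessLib

/-!
# Crux `DrainImpliesDisperse` (stmt-FinalStateConjecture-17283), negative side, PRIMITIVE FORM:
# the chart-rigidity clause of the pulsed-observer witness reduced to PROPERNESS

`Negative.DrainImpliesDisperse_false_of_pulsedObserverDevelopmentExists` refutes the crux as filed on a
drained censored development carrying a persistently pulsed observer, modulo the construction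
hypothesis `PulsedObserverDevelopmentExists`, whose clause (A) asks that every entire,
`C²`-asymptotically flat, eventually future-oriented late chart of the flat background into `J⁺(ι X)`
have eventually ACHRONAL slabs. With the landed chart lemma
`Theorems.DrainImpliesDisperse.isAchronal_slab_of_proper_pinched` (late slabs of a proper, pinched,
future-oriented chart are achronal: the chart time is strictly increasing along future timelike curves
in the pinched region, and a timelike curve leaving that region from a late slab first meets a lower
slab by properness) clause (A) follows from the more primitive tameness clause

* (P) every such chart is EVENTUALLY PROPER: `Φ({x⁰ ≥ τ₁} ∩ U)` is closed in `M` for all late `τ₁`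

(`eventually_isAchronal_of_eventually_proper`: `C²`-decay on entire slabs gives the `C⁰`-pinching
`‖(Φ^*g − η)(x)‖ < 1/4` beyond a late chart time, and `IsFutureOriented`-type orientation is the
remaining input). This file records the witness in that primitive form,
`ProperPulsedObserverDevelopmentExists` — (T) a future timelike worldline `c` on `[0, ∞)`, (R) ray-borne,
(V) seeing all of `J⁺(ι X)`, (W) with a recurrent frame-independent `C²` floor, in a drained censored
maximal development of an admissible datum in which (P) holds —, so that `H'` implies the hypothesis
`H = PulsedObserverDevelopmentExists` of the first negative lemma field by field, and proves the negative
lemma `DrainImpliesDisperse_false_of_properPulsedObserverDevelopmentExists`. On paper (P) is the standard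
completeness/properness of asymptotically isometric embeddings of entire late half-spaces into the
complete near-Minkowskian development of the far-field ripple datum `δ + ε r⁻¹⁰ sin(r⁴) w₀`
(`Cruxes/DrainImpliesDisperse/REPORT-c3.md`, REPORT-c4.md); it is exactly hypothesis (E2) that line
`registered` imposes on its own radiative end. Not constructible in the tree (no maximal development of
a non-flat admissible datum). Line lead `prover-line-stmt-FinalStateConjecture-17283-c4-0`, 2026-08-17.
-/

noncomputable section

set_option linter.dupNamespace false -- D-0017: `Summit.<S>.<S>.…` by design

open Set Filter Function TopologicalSpace Topology
open scoped Manifold ContDiff Topology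

namespace Summit.FinalStateConjecture.FinalStateConjecture.Theorems.DrainImpliesDisperse.Negative

open Literature.Geometry.Lorentzian
open Summit.FinalStateConjecture (HasCompleteNullInfinity)
open Summit.FinalStateConjecture.FinalStateConjecture.Theses.BondiDrainDispersal (DrainImpliesDisperse)

/-- **`C²`-decay, eventual future orientation and eventual properness give eventually achronal
slabs.** For a late chart `Φ` of the flat background over `U ⊆ E4` (smooth, open embedding of
`{x⁰ > τ₀} ∩ U`) whose `C²` deviation on the entire slabs `{x⁰ = τ}` tends to `0`, whose `Φ_*∂₀` is
eventually future-directed on slabs, and whose images `Φ({x⁰ ≥ τ₁} ∩ U)` are closed for all late `τ₁`,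
the slabs `Φ({x⁰ = τ} ∩ U)` are achronal for all late `τ`: beyond a late chart time the deviation is
`C⁰`-pinched (`‖(Φ^*g − η)(x)‖ ≤ deviationCk … 2 (x⁰) < 1/4`, the order-`0` term of the `C²` sup norm)
and oriented, and `isAchronal_slab_of_proper_pinched` applies. O'Neill 1983, Ch. 14, p. 413.
[cite: ONeillSemiRiemannian1983, Ch. 14, p. 413] -/
theorem eventually_isAchronal_of_eventually_proper (𝓢 : Spacetime 4) (U : Opens E4) (τ₀ : ℝ)
    (Φ : (Minkowski.backgroundOn U).domain → 𝓢.carrier) (O : Set 𝓢.carrier)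
    (hlate : 𝓢.IsLateChart (Minkowski.backgroundOn U) O τ₀ Φ)
    (hdec : Tendsto (fun τ ↦ 𝓢.deviationCk (Minkowski.backgroundOn U) Φ 2 τ) atTop (𝓝 0))
    (hfut : ∀ᶠ τ in atTop, ∀ x ∈ (Minkowski.backgroundOn U).timeSlab τ,
      𝓢.timeOrientation.IsFutureDirected (mfderiv 𝓘(ℝ, E4) (𝓡 4) Φ x (E4.basisVector 0)))
    (hprop : ∀ᶠ τ₁ in atTop,
      IsClosed (Φ '' {x : (Minkowski.backgroundOn U).domain | τ₁ ≤ (x : E4) 0})) :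
    ∀ᶠ τ in atTop,
      𝓢.metric.IsAchronal 𝓢.timeOrientation (Φ '' (Minkowski.backgroundOn U).timeSlab τ) := by
  -- eventually the `C²` deviation on entire slabs is `< 1/4`
  have hquarter : (0 : ENNReal) < ENNReal.ofReal (1 / 4) := ENNReal.ofReal_pos.2 (by norm_num)
  have hpinch : ∀ᶠ τ in atTop,
      𝓢.deviationCk (Minkowski.backgroundOn U) Φ 2 τ < ENNReal.ofReal (1 / 4) :=
    (tendsto_order.1 hdec).2 _ hquarter
  obtain ⟨T₁, hT₁⟩ := eventually_atTop.1 (hpinch.and (hfut.and hprop))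
  -- a late level `τ₁ > τ₀`, `τ₁ ≥ T₁`
  obtain ⟨τ₁, hτ₁T, h01⟩ : ∃ τ₁ : ℝ, T₁ ≤ τ₁ ∧ τ₀ < τ₁ :=
    ⟨max T₁ (τ₀ + 1), le_max_left _ _, (lt_add_one _).trans_le (le_max_right _ _)⟩
  -- `C⁰`-pinching beyond `T₁`
  have hpin : ∀ x : (Minkowski.backgroundOn U).domain, τ₁ < (x : E4) 0 →
      ‖𝓢.deviation (Minkowski.backgroundOn U) Φ x‖ < 1 / 4 := by
    intro x hx
    have h1 := (hT₁ _ (hτ₁T.trans hx.le)).1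
    have hxslab : (x : E4) ∈
        Subtype.val '' (Minkowski.backgroundOn U).timeSlab ((x : E4) 0) := ⟨x, rfl, rfl⟩
    have h2 : ‖iteratedFDeriv ℝ 0 (𝓢.deviationExtend (Minkowski.backgroundOn U) Φ) (x : E4)‖ₑ ≤
        𝓢.deviationCk (Minkowski.backgroundOn U) Φ 2 ((x : E4) 0) :=
      enorm_iteratedFDeriv_le_supCkENorm (Nat.zero_le 2) hxslab _
    have h3 : ‖iteratedFDeriv ℝ 0 (𝓢.deviationExtend (Minkowski.backgroundOn U) Φ) (x : E4)‖ =
        ‖𝓢.deviation (Minkowski.backgroundOn U) Φ x‖ := by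
      rw [norm_iteratedFDeriv_zero, Spacetime.deviationExtend_coe]
    have h4 : ENNReal.ofReal ‖𝓢.deviation (Minkowski.backgroundOn U) Φ x‖ <
        ENNReal.ofReal (1 / 4) := by
      rw [← h3, ofReal_norm]
      exact h2.trans_lt h1
    exact (ENNReal.ofReal_lt_ofReal_iff (by norm_num)).1 h4
  -- orientation beyond `T₁`
  have hfut' : ∀ x : (Minkowski.backgroundOn U).domain, τ₁ < (x : E4) 0 →
      𝓢.timeOrientation.IsFutureDirected (mfderiv 𝓘(ℝ, E4) (𝓡 4) Φ x (E4.basisVector 0)) :=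
    fun x hx ↦ (hT₁ _ (hτ₁T.trans hx.le)).2.1 x rfl
  -- properness at level `τ₁`
  have hcl : IsClosed (Φ '' {x : (Minkowski.backgroundOn U).domain | τ₁ ≤ (x : E4) 0}) :=
    (hT₁ τ₁ hτ₁T).2.2
  filter_upwards [eventually_gt_atTop τ₁] with τ hτ
  exact isAchronal_slab_of_proper_pinched 𝓢 U Φ τ₀ τ₁ h01 hlate.contMDiff hlate.isOpenEmbedding
    hcl hpin hfut' τ hτ

/-- **Construction hypothesis `H'` (primitive form of `PulsedObserverDevelopmentExists`): a drained
censored development with a persistently pulsed observer whose asymptotically flat entire late charts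
are eventually PROPER.** Some admissible datum has a maximal vacuum Cauchy development `𝒟` with
complete future null infinity (sojourn form) and vanishing final Bondi mass, a curve `c : ℝ → M` and a
floor `0 < δ`, such that: (T) `c` is a future timelike curve on `[0, ∞)`; (R) every event `c s`, `s ≥ 0`,
lies on a future-complete normalised null ray from the data hypersurface at an affine parameter `≥ 0`;
(V) `∀ a ∈ J⁺(ι X), ∃ s ≥ 0, a ≪ c s`; (W) for every `s₀` there is `s > s₀` such that no local chart of
the flat background through `c s` is `δ`-quiet in `C²` there (for every open `U ⊆ E4`, smooth
`Φ : U → M`, open `V ⊆ U` on which `Φ` is an open embedding, `x ∈ V` with `Φ x = c s`: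
`δ ≤ supCkENorm {x} 2 (Φ^* g − η)`); (P) every late chart `Φ` of the flat background over an open
`U ⊇ {x⁰ > τ₀}` into `J⁺(ι X)` (`Spacetime.IsLateChart`) whose `C²` deviation on the entire slabs
`{x⁰ = τ}` tends to `0` and whose push-forward of `∂₀` is eventually future-directed on the slabs is
EVENTUALLY PROPER: `Φ({x⁰ ≥ τ₁} ∩ U)` is closed in `M` for all late `τ₁`. Expected on paper for the
maximal development of the far-field ripple datum `δ + ε r⁻¹⁰ sin(r⁴) w₀` of
`Cruxes/DrainImpliesDisperse/REPORT-c3.md` (central geodesic `c`; (P) = completeness of asymptotically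
isometric embeddings of entire half-spaces into a complete near-Minkowskian spacetime). NOT
constructible in the tree today (no maximal development of any non-flat admissible datum). This is
the construction hypothesis of a negative lemma, not a published fact (no citation tag). -/
def ProperPulsedObserverDevelopmentExists : Prop :=
  ∃ (X : Type) (_ : TopologicalSpace X) (_ : ChartedSpace E3 X) (_ : IsManifold (𝓡 3) ∞ X)
    (_ : T2Space X) (_ : SecondCountableTopology X) (_ : ConnectedSpace X)
    (D : InitialDataSet (𝓡 3) X) (_ : D ∈ admissibleVacuumData X) (𝒟 : VacuumCauchyDevelopment D)
    (_ : 𝒟.IsMaximal) (_ : HasCompleteNullInfinity 𝒟.toCauchyDevelopment)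
    (_ : 𝒟.toCauchyDevelopment.HasVanishingFinalBondiMass) (c : ℝ → 𝒟.carrier) (δ : ENNReal),
    0 < δ ∧
    𝒟.metric.IsFutureTimelikeCurveOn 𝒟.timeOrientation c (Ici 0) ∧
    (∀ [𝒟.metric.HasLeviCivita], ∀ s : ℝ, 0 ≤ s →
      ∃ (p : X) (γ : ℝ → 𝒟.carrier) (dom : Set ℝ) (t : ℝ),
        𝒟.metric.IsNormalisedNullRayFrom 𝒟.timeOrientation 𝒟.embed 𝒟.normal p γ dom ∧
          ¬ BddAbove dom ∧ t ∈ dom ∧ 0 ≤ t ∧ γ t = c s) ∧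
    (∀ a ∈ 𝒟.metric.causalFuture 𝒟.timeOrientation (range 𝒟.embed),
      ∃ s : ℝ, 0 ≤ s ∧ c s ∈ 𝒟.metric.chronologicalFuture 𝒟.timeOrientation {a}) ∧
    (∀ s₀ : ℝ, ∃ s : ℝ, s₀ < s ∧
      ∀ (U : Opens E4) (Φ : (Minkowski.backgroundOn U).domain → 𝒟.carrier)
        (V : Set (Minkowski.backgroundOn U).domain) (x : (Minkowski.backgroundOn U).domain),
        IsOpen V → x ∈ V → ContMDiff 𝓘(ℝ, E4) (𝓡 4) ∞ Φ → IsOpenEmbedding (V.restrict Φ) →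
        Φ x = c s →
        δ ≤ supCkENorm {(x : E4)} 2 (𝒟.toSpacetime.deviationExtend (Minkowski.backgroundOn U) Φ)) ∧
    (∀ (U : Opens E4) (τ₀ : ℝ) (Φ : (Minkowski.backgroundOn U).domain → 𝒟.carrier),
      Minkowski.lateRegion τ₀ ⊆ (U : Set E4) →
      𝒟.toSpacetime.IsLateChart (Minkowski.backgroundOn U)
        (𝒟.metric.causalFuture 𝒟.timeOrientation (range 𝒟.embed)) τ₀ Φ →
      Tendsto (fun τ ↦ 𝒟.toSpacetime.deviationCk (Minkowski.backgroundOn U) Φ 2 τ) atTop (𝓝 0) →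
      (∀ᶠ τ in atTop, ∀ x ∈ (Minkowski.backgroundOn U).timeSlab τ,
        𝒟.timeOrientation.IsFutureDirected (mfderiv 𝓘(ℝ, E4) (𝓡 4) Φ x (E4.basisVector 0))) →
      ∀ᶠ τ₁ in atTop,
        IsClosed (Φ '' {x : (Minkowski.backgroundOn U).domain | τ₁ ≤ (x : E4) 0}))

/-- **Negative lemma modulo `ProperPulsedObserverDevelopmentExists`** (primitive form): one drained
censored maximal development of one admissible datum carrying a persistently pulsed, ray-borne,
all-seeing observer, in which asymptotically flat entire late charts are eventually proper, falsifies
`DrainImpliesDisperse` as filed — the binder form `drainImpliesDisperse_false_of_pulsedObserver` fed with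
the achronality clause supplied by `eventually_isAchronal_of_eventually_proper` (so `H'` implies the
hypothesis `H = PulsedObserverDevelopmentExists` of the first negative lemma field by field). [folklore] -/
theorem DrainImpliesDisperse_false_of_properPulsedObserverDevelopmentExists
    (H : ProperPulsedObserverDevelopmentExists) : ¬ DrainImpliesDisperse := by
  obtain ⟨X, _, _, _, _, _, _, D, hD, 𝒟, hmax, hcni, hdrain, c, δ, hδ, hc, hray, hvis, hwild, hprop⟩ :=
    H
  exact drainImpliesDisperse_false_of_pulsedObserver X D hD 𝒟 hmax hcni hdrain c δ hδ hc hray hvis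
    hwild fun U τ₀ Φ hU hlate hdec hfut ↦ eventually_isAchronal_of_eventually_proper 𝒟.toSpacetime U
      τ₀ Φ _ hlate hdec hfut (hprop U τ₀ Φ hU hlate hdec hfut)

end Summit.FinalStateConjecture.FinalStateConjecture.Theorems.DrainImpliesDisperse.Negative

end
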